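import Mathlib
import Summits.ResolutionOfSingularities.ResolutionOfSingularities.Theorems.RadicialJungCleanModelsCleanProp44OfCurveSliceVN
import Summits.ResolutionOfSingularities.ResolutionOfSingularities.Theorems.RadicialJungCleanModelsCleanProp44TauTwoRegime
import Summits.ResolutionOfSingularities.ResolutionOfSingularities.Theorems.RadicialJungCleanModelsCleanReachPhaseOne
import Summits.ResolutionOfSingularities.ResolutionOfSingularities.Theorems.RadicialJungCleanModelsCleanPermissibleSeqComp
import Summits.ResolutionOfSingularities.ResolutionOfSingularities.Theorems.FrobeniusLadderFInjectiveMacaulayficationProp44ReachTidy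
import Summits.ResolutionOfSingularities.ResolutionOfSingularities.Theorems.FrobeniusLadderFInjectiveMacaulayficationProp44CurveStepRT
import Summits.ResolutionOfSingularities.ResolutionOfSingularities.Theorems.FrobeniusLadderFInjectiveMacaulayficationProp44Invariants
import Literature.AlgebraicGeometry.Resolution.BlowupsExistence
import HarnessLib

/-!
# Route `RadicialJung`, crux `CleanModels` (stmt-ResolutionOfSingularities-15917), line `Sketch` rev 35, stub 6 `stub_cleanProp44` (X44c):
# ELEVENTH CUT — the clean-permissible part of clean Phase II is ABSORBED by the printed potential; (R1) ⟸ (R1ⁿᶜᵖ)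

Seat decomp-res-hand-2 g17 (structural hand: «reduce to the most general landed lemma, then specialise»), sequel of the tenth cut
✓ `cleanProp44_of_phaseTwo_of_curveTauOneVN : (R1) → (R3ᵛⁿ′) → X44c` (`…CleanProp44OfCurveSliceVN.lean`, hand-2 g16).

(R1) = CLEAN PHASE II of reach-tidy ([CoP1] Prop. 4.4, proof p. 10, step 3, with clean-permissible centres): from a stage WITHOUT BAD POINTS
(the curves of `Σ = {ord ≥ μ}` are regular and pairwise transverse) reach, by a clean-permissible sequence, a TIDY stage (curves regular and
pairwise disjoint).  The tree proves the non-clean step 3 by blowing up any intersecting curve of `Σ` and letting the potential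
`Λ = Σ_{η} λ(𝒪_{X,η}/J_η)` (sum over the generic points of the curves of `Σ`) drop (✓ `CP2008Prop44.curveStep_potential_lt`, no bad point
upstairs ✓ `CP2008Prop44.curveStep_noBad`).  In the clean world that blowing up is allowed exactly when the curve is CLEAN-PERMISSIBLE at each of
its points for the current transform of `G` (`IsCleanPermissibleSeq.cons`).  This file runs the printed loop for as long as SOME intersecting
curve of `Σ` is clean-permissible everywhere (strong induction on `Λ`), so that the research content of (R1) is confined, BY A KERNEL THEOREM, to

  (R1ⁿᶜᵖ) «no-bad stages of a clean threefold at which two curves of `Σ` meet and EVERY curve of `Σ` meeting another one has a point at which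
  the line of `G` is NOT clean-permissible for it» — i.e. the stages where L7b insertions (✓ `exists_isCleanPermissibleSeq_blowup_curve_of_base`)
  are FORCED on every candidate centre.

* `exists_isCleanPermissibleSeq_tidy_of_noBad_of_NCP` — (R1) at one stage from the schema (R1ⁿᶜᵖ) (at the same prime `p`): either no two curves
  meet (tidy: done), or some meeting curve is clean-permissible everywhere (blow it up: clean step, no bad point upstairs, `Λ` drops — recurse),
  or the stage is an (R1ⁿᶜᵖ) stage (apply the hypothesis there, to the transform of `G`, which is clean-regular everywhere by
  ✓ `IsCleanPermissibleSeq.cleanRegAt`, and compose ✓ `IsCleanPermissibleSeq.comp`).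
* `phaseTwo_of_phaseTwoNCP` — **(R1) ⟸ (R1ⁿᶜᵖ)** as an implication of hypothesis schemas (binders of `hphaseTwo` of the tenth cut VERBATIM).
* `cleanProp44_of_phaseTwoNCP_of_curveTauOneVN` — **ELEVENTH CUT: X44c (`stub_cleanProp44`, verbatim) ⟸ (R1ⁿᶜᵖ) ∧ (R3ᵛⁿ′)**.

NET for the planner (repair census of stub 6, by name): X44c ⟸ (R1ⁿᶜᵖ) clean Phase II at stages where insertions are forced on every
intersecting `Σ`-curve [L–XL: near lines born by the insertions, [CoP1] Lemma 4.3 (5)] ∧ (R3ᵛⁿ′) the clean curve slice through a `τ = 1` point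
for curves needing an insertion or carrying a very near point [XL].  RE-LINE proposal: `stub_cleanProp44 :=
cleanProp44_of_phaseTwoNCP_of_curveTauOneVN stub_cleanPhaseTwoNCP stub_cleanCurveTauOneVN`.

Honest framing: OURS; (R1ⁿᶜᵖ) and (R3ᵛⁿ′) are NOT proved here; nothing here proves X44c, any case of `CleanModels`, or resolution of
singularities in characteristic `p`. [cite: CossartPiltant2008, Prop. 4.4 (proof, p. 10, step 3); Lemma 4.3 (2) (4)] [cite: Piltant2013, §2 Axiom 4]
-/

noncomputable section

set_option linter.dupNamespace false -- mandated namespace of this single-conjunct summit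

open CategoryTheory CategoryTheory.Limits AlgebraicGeometry TopologicalSpace IsLocalRing
open Literature.AlgebraicGeometry.Resolution Literature.AlgebraicGeometry.Motives
open Scheme.IdealSheafData
open Summit.ResolutionOfSingularities.ResolutionOfSingularities.Theorems.CP2008Prop44

namespace Summit.ResolutionOfSingularities.ResolutionOfSingularities.Theorems.RadicialJung.CleanModels

/-! ## §1 Clean Phase II from its insertion-forced residual, at one stage -/

set_option maxHeartbeats 1600000 in
-- long binder lists and a three-way case analysis at every reachable stage
/-- **Clean Phase II of reach-tidy from the residual (R1ⁿᶜᵖ).**  `X` integral Noetherian regular quasi-excellent of dimension `≤ 3` with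
function field of characteristic `p`, the line of `G` clean-regular at every point, `(J, μ)` with `μ ≥ 1`, `ord ≤ μ`, `V(J)` of codimension `≥ 2`,
and NO BAD POINT (every curve of `Σ = {ord ≥ μ}` is regular, any two meet transversally).  Suppose (R1ⁿᶜᵖ) at the prime `p`: every such stage at
which moreover two curves of `Σ` meet and every curve of `Σ` meeting another one carries a point where the line is not clean-permissible for it,
reaches a tidy stage by a clean-permissible sequence.  Then `X` reaches a tidy stage by a clean-permissible sequence.  Proof: strong induction on
the printed potential `Λ` — a meeting curve clean-permissible everywhere is blown up (✓ `IsCleanPermissibleSeq.cons`; no bad point upstairs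
✓ `curveStep_noBad`; `Λ` drops ✓ `curveStep_potential_lt`); otherwise the stage is tidy or an (R1ⁿᶜᵖ) stage.
[cite: CossartPiltant2008, Prop. 4.4 (proof, p. 10, step 3)] [cite: Piltant2013, §2 Axiom 4] -/
theorem exists_isCleanPermissibleSeq_tidy_of_noBad_of_NCP {p : ℕ} (hp : p.Prime) {X : Scheme.{0}} [IsIntegral X] [IsNoetherian X]
    [hcharX : CharP X.functionField p] (hX : Scheme.IsRegular X) (hqe : Scheme.IsQuasiExcellent X) (hX3 : topologicalKrullDim X ≤ 3)
    (G : X.functionField) (hG : ∀ x : X, CleanRegAt p (algebraMap (X.presheaf.stalk x) X.functionField) G)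
    (J : X.IdealSheafData) {μ : ℕ} (hμ : 1 ≤ μ) (hle : ∀ z, idealOrder J z ≤ μ) (hcodim : ∀ z ∈ J.support, 1 < Order.coheight z)
    (hRT : ∀ x : X, ¬ ∃ C ∈ {C : Closeds X | ∃ ζ ∈ maxPoints {z : X | (μ : ℕ∞) ≤ idealOrder J z},
        ¬ IsClosed ({ζ} : Set X) ∧ C = ⟨closure {ζ}, isClosed_closure⟩},
      x ∈ (vanishingIdeal C).subschemeι '' (Scheme.regularLocus (vanishingIdeal C).subscheme)ᶜ ∨
      (x ∈ (C : Set X) ∧ ∃ C' ∈ {C : Closeds X | ∃ ζ ∈ maxPoints {z : X | (μ : ℕ∞) ≤ idealOrder J z},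
          ¬ IsClosed ({ζ} : Set X) ∧ C = ⟨closure {ζ}, isClosed_closure⟩}, C' ≠ C ∧ x ∈ (C' : Set X) ∧
        stalkIdeal (vanishingIdeal C) x ⊔ stalkIdeal (vanishingIdeal C') x ≠ maximalIdeal (X.presheaf.stalk x)))
    (hNCP : ∀ {X : Scheme.{0}} [IsIntegral X] [IsNoetherian X], CharP X.functionField p →
      ∀ (hX : Scheme.IsRegular X), Scheme.IsQuasiExcellent X → topologicalKrullDim X ≤ 3 →
      ∀ (G : X.functionField), (∀ x : X, CleanRegAt p (algebraMap (X.presheaf.stalk x) X.functionField) G) →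
      ∀ (J : X.IdealSheafData), (∀ z, idealOrder J z ≤ μ) → (∀ z ∈ J.support, 1 < Order.coheight z) →
      (∀ x : X, ¬ ∃ C ∈ {C : Closeds X | ∃ ζ ∈ maxPoints {z : X | (μ : ℕ∞) ≤ idealOrder J z},
          ¬ IsClosed ({ζ} : Set X) ∧ C = ⟨closure {ζ}, isClosed_closure⟩},
        x ∈ (vanishingIdeal C).subschemeι '' (Scheme.regularLocus (vanishingIdeal C).subscheme)ᶜ ∨
        (x ∈ (C : Set X) ∧ ∃ C' ∈ {C : Closeds X | ∃ ζ ∈ maxPoints {z : X | (μ : ℕ∞) ≤ idealOrder J z},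
            ¬ IsClosed ({ζ} : Set X) ∧ C = ⟨closure {ζ}, isClosed_closure⟩}, C' ≠ C ∧ x ∈ (C' : Set X) ∧
          stalkIdeal (vanishingIdeal C) x ⊔ stalkIdeal (vanishingIdeal C') x ≠ maximalIdeal (X.presheaf.stalk x))) →
      -- (meet) two distinct curves of `Σ` meet
      (∃ ζ₁ ζ₂ : X, (μ : ℕ∞) ≤ idealOrder J ζ₁ ∧ Order.coheight ζ₁ = 2 ∧ ¬ IsClosed ({ζ₁} : Set X) ∧
          (μ : ℕ∞) ≤ idealOrder J ζ₂ ∧ Order.coheight ζ₂ = 2 ∧ ¬ IsClosed ({ζ₂} : Set X) ∧ ζ₁ ≠ ζ₂ ∧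
          ¬ Disjoint (closure ({ζ₁} : Set X)) (closure {ζ₂})) →
      -- (ncp) every curve of `Σ` meeting another one has a point at which the line is NOT clean-permissible for it
      (∀ ζ₁ : X, (μ : ℕ∞) ≤ idealOrder J ζ₁ → Order.coheight ζ₁ = 2 → ¬ IsClosed ({ζ₁} : Set X) →
          (∃ ζ₂ : X, (μ : ℕ∞) ≤ idealOrder J ζ₂ ∧ Order.coheight ζ₂ = 2 ∧ ¬ IsClosed ({ζ₂} : Set X) ∧ ζ₁ ≠ ζ₂ ∧
            ¬ Disjoint (closure ({ζ₁} : Set X)) (closure {ζ₂})) →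
          ∃ y ∈ closure ({ζ₁} : Set X), ¬ CleanPermissibleAt p (algebraMap (X.presheaf.stalk y) X.functionField) G
            (stalkIdeal (vanishingIdeal (⟨closure {ζ₁}, isClosed_closure⟩ : Closeds X)) y)) →
      ∃ (X₁ : Scheme.{0}) (Φ : X₁ ⟶ X) (_ : IsIntegral X₁) (_ : IsDominant Φ) (J₁ : X₁.IdealSheafData)
        (_ : IsCleanPermissibleSeq p Φ J μ J₁ G),
        (∀ ζ : X₁, (μ : ℕ∞) ≤ idealOrder J₁ ζ → Order.coheight ζ = 2 → ¬ IsClosed ({ζ} : Set X₁) →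
            Scheme.IsRegular (vanishingIdeal (⟨closure {ζ}, isClosed_closure⟩ : Closeds X₁)).subscheme) ∧
        (∀ ζ₁ ζ₂ : X₁, (μ : ℕ∞) ≤ idealOrder J₁ ζ₁ → Order.coheight ζ₁ = 2 → ¬ IsClosed ({ζ₁} : Set X₁) →
            (μ : ℕ∞) ≤ idealOrder J₁ ζ₂ → Order.coheight ζ₂ = 2 → ¬ IsClosed ({ζ₂} : Set X₁) → ζ₁ ≠ ζ₂ →
            Disjoint (closure ({ζ₁} : Set X₁)) (closure {ζ₂}))) :
    ∃ (X₁ : Scheme.{0}) (Φ : X₁ ⟶ X) (_ : IsIntegral X₁) (_ : IsDominant Φ) (J₁ : X₁.IdealSheafData)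
      (_ : IsCleanPermissibleSeq p Φ J μ J₁ G),
      (∀ ζ : X₁, (μ : ℕ∞) ≤ idealOrder J₁ ζ → Order.coheight ζ = 2 → ¬ IsClosed ({ζ} : Set X₁) →
          Scheme.IsRegular (vanishingIdeal (⟨closure {ζ}, isClosed_closure⟩ : Closeds X₁)).subscheme) ∧
      (∀ ζ₁ ζ₂ : X₁, (μ : ℕ∞) ≤ idealOrder J₁ ζ₁ → Order.coheight ζ₁ = 2 → ¬ IsClosed ({ζ₁} : Set X₁) →
          (μ : ℕ∞) ≤ idealOrder J₁ ζ₂ → Order.coheight ζ₂ = 2 → ¬ IsClosed ({ζ₂} : Set X₁) → ζ₁ ≠ ζ₂ →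
          Disjoint (closure ({ζ₁} : Set X₁)) (closure {ζ₂})) := by
  classical
  -- the invariants at every reachable stage (over the forgetful map to the W4.6 currency)
  have inv := fun {X₁ : Scheme.{0}} [IsIntegral X₁] {Φ : X₁ ⟶ X} [IsDominant Φ] {J₁ : X₁.IdealSheafData}
      (h : IsCleanPermissibleSeq p Φ J μ J₁ G) =>
    IsPermissibleBlowupSeq.prop44Invariants hX hqe hμ hle hcodim (isPermissibleBlowupSeq_of_isPermissibleSeq h.isPermissibleSeq)
  -- finitely many curves of `Σ` at every reachable stage
  have hfin : ∀ {X₁ : Scheme.{0}} [IsIntegral X₁] {Φ : X₁ ⟶ X} [IsDominant Φ] {J₁ : X₁.IdealSheafData},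
      IsCleanPermissibleSeq p Φ J μ J₁ G →
      {ζ : X₁ | ζ ∈ maxPoints {z : X₁ | (μ : ℕ∞) ≤ idealOrder J₁ z} ∧ ¬ IsClosed ({ζ} : Set X₁)}.Finite := by
    intro X₁ _ Φ _ J₁ h
    obtain ⟨-, hnoeth₁, hX₁, hqe₁, -, hcodim₁⟩ := inv h
    haveI := hnoeth₁
    have hJne : J₁ ≠ ⊥ := ne_bot_of_forall_one_lt_coheight hcodim₁
    have hcl : IsClosed {z : X₁ | (μ : ℕ∞) ≤ idealOrder J₁ z} :=
      isClosed_setOf_le_idealOrder_of_isJ2 hX₁ (fun U => (hqe₁ U).isJ2Ring) hJne μ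
    exact (maxPoints_finite hcl).subset fun ζ hζ => hζ.1
  -- ONE STEP at a reachable stage without bad points: the answer, or a reachable stage without bad points and with smaller `Λ`
  have step : ∀ (X₁ : Scheme.{0}) [IsIntegral X₁] (Φ : X₁ ⟶ X) [IsDominant Φ] (J₁ : X₁.IdealSheafData),
      IsCleanPermissibleSeq p Φ J μ J₁ G →
      (∀ x : X₁, ¬ ∃ C ∈ {C : Closeds X₁ | ∃ ζ ∈ maxPoints {z : X₁ | (μ : ℕ∞) ≤ idealOrder J₁ z},
          ¬ IsClosed ({ζ} : Set X₁) ∧ C = ⟨closure {ζ}, isClosed_closure⟩},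
        x ∈ (vanishingIdeal C).subschemeι '' (Scheme.regularLocus (vanishingIdeal C).subscheme)ᶜ ∨
        (x ∈ (C : Set X₁) ∧ ∃ C' ∈ {C : Closeds X₁ | ∃ ζ ∈ maxPoints {z : X₁ | (μ : ℕ∞) ≤ idealOrder J₁ z},
            ¬ IsClosed ({ζ} : Set X₁) ∧ C = ⟨closure {ζ}, isClosed_closure⟩}, C' ≠ C ∧ x ∈ (C' : Set X₁) ∧
          stalkIdeal (vanishingIdeal C) x ⊔ stalkIdeal (vanishingIdeal C') x ≠ maximalIdeal (X₁.presheaf.stalk x))) →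
      (∃ (X₂ : Scheme.{0}) (Ψ : X₂ ⟶ X) (_ : IsIntegral X₂) (_ : IsDominant Ψ) (J₂ : X₂.IdealSheafData)
          (_ : IsCleanPermissibleSeq p Ψ J μ J₂ G),
          (∀ ζ : X₂, (μ : ℕ∞) ≤ idealOrder J₂ ζ → Order.coheight ζ = 2 → ¬ IsClosed ({ζ} : Set X₂) →
              Scheme.IsRegular (vanishingIdeal (⟨closure {ζ}, isClosed_closure⟩ : Closeds X₂)).subscheme) ∧
          (∀ ζ₁ ζ₂ : X₂, (μ : ℕ∞) ≤ idealOrder J₂ ζ₁ → Order.coheight ζ₁ = 2 → ¬ IsClosed ({ζ₁} : Set X₂) →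
              (μ : ℕ∞) ≤ idealOrder J₂ ζ₂ → Order.coheight ζ₂ = 2 → ¬ IsClosed ({ζ₂} : Set X₂) → ζ₁ ≠ ζ₂ →
              Disjoint (closure ({ζ₁} : Set X₂)) (closure {ζ₂}))) ∨
      (∃ (X₂ : Scheme.{0}) (_ : IsIntegral X₂) (Φ₂ : X₂ ⟶ X) (_ : IsDominant Φ₂) (J₂ : X₂.IdealSheafData),
          IsCleanPermissibleSeq p Φ₂ J μ J₂ G ∧
          (∀ x : X₂, ¬ ∃ C ∈ {C : Closeds X₂ | ∃ ζ ∈ maxPoints {z : X₂ | (μ : ℕ∞) ≤ idealOrder J₂ z},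
              ¬ IsClosed ({ζ} : Set X₂) ∧ C = ⟨closure {ζ}, isClosed_closure⟩},
            x ∈ (vanishingIdeal C).subschemeι '' (Scheme.regularLocus (vanishingIdeal C).subscheme)ᶜ ∨
            (x ∈ (C : Set X₂) ∧ ∃ C' ∈ {C : Closeds X₂ | ∃ ζ ∈ maxPoints {z : X₂ | (μ : ℕ∞) ≤ idealOrder J₂ z},
                ¬ IsClosed ({ζ} : Set X₂) ∧ C = ⟨closure {ζ}, isClosed_closure⟩}, C' ≠ C ∧ x ∈ (C' : Set X₂) ∧
              stalkIdeal (vanishingIdeal C) x ⊔ stalkIdeal (vanishingIdeal C') x ≠ maximalIdeal (X₂.presheaf.stalk x))) ∧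
          (∑ᶠ ζ ∈ {ζ : X₂ | ζ ∈ maxPoints {z : X₂ | (μ : ℕ∞) ≤ idealOrder J₂ z} ∧ ¬ IsClosed ({ζ} : Set X₂)},
              (Module.length (X₂.presheaf.stalk ζ) (X₂.presheaf.stalk ζ ⧸ stalkIdeal J₂ ζ)).toNat) <
            ∑ᶠ ζ ∈ {ζ : X₁ | ζ ∈ maxPoints {z : X₁ | (μ : ℕ∞) ≤ idealOrder J₁ z} ∧ ¬ IsClosed ({ζ} : Set X₁)},
              (Module.length (X₁.presheaf.stalk ζ) (X₁.presheaf.stalk ζ ⧸ stalkIdeal J₁ ζ)).toNat) := by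
    intro X₁ _ Φ _ J₁ hseq hI
    obtain ⟨-, hnoeth₁, hX₁, hqe₁, hle₁, hcodim₁⟩ := inv hseq
    haveI := hnoeth₁
    have hX3₁ : topologicalKrullDim X₁ ≤ 3 :=
      (isPermissibleBlowupSeq_of_isPermissibleSeq hseq.isPermissibleSeq).topologicalKrullDim_le inferInstance hX3
    have hcoh3 : ∀ z : X₁, Order.coheight z ≤ 3 := (topologicalKrullDim_le_iff_forall_coheight_le X₁ 3).mp hX3₁
    haveI hcharX₁ : CharP X₁.functionField p := charP_of_injective_ringHom (RatFn.functionFieldMap Φ).injective p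
    -- the line stays clean-regular at every point of the stage
    have hG₁ : ∀ x : X₁, CleanRegAt p (algebraMap (X₁.presheaf.stalk x) X₁.functionField) (RatFn.functionFieldMap Φ G) :=
      hseq.cleanRegAt hp hcharX hG
    -- the curves of `Σ` are regular (no bad point)
    have hREG : ∀ ζ : X₁, (μ : ℕ∞) ≤ idealOrder J₁ ζ → Order.coheight ζ = 2 → ¬ IsClosed ({ζ} : Set X₁) →
        Scheme.IsRegular (vanishingIdeal (⟨closure {ζ}, isClosed_closure⟩ : Closeds X₁)).subscheme :=
      fun ζ hζ hcoh hcl => (curve_of_noBad hX₁ hX3₁ J₁ hμ hle₁ hcodim₁ (𝒞 := {C : Closeds X₁ | _}) (fun C => Iff.rfl) hI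
        ⟨ζ, mem_maxPoints_setOf_of_coheight_eq_two hμ hcoh3 hcodim₁ hζ hcoh, hcl, rfl⟩).1
    by_cases hmeet : ∃ ζ₁ ζ₂ : X₁, (μ : ℕ∞) ≤ idealOrder J₁ ζ₁ ∧ Order.coheight ζ₁ = 2 ∧ ¬ IsClosed ({ζ₁} : Set X₁) ∧
        (μ : ℕ∞) ≤ idealOrder J₁ ζ₂ ∧ Order.coheight ζ₂ = 2 ∧ ¬ IsClosed ({ζ₂} : Set X₁) ∧ ζ₁ ≠ ζ₂ ∧
        ¬ Disjoint (closure ({ζ₁} : Set X₁)) (closure {ζ₂})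
    · by_cases hCP : ∃ ζ₁ : X₁, (μ : ℕ∞) ≤ idealOrder J₁ ζ₁ ∧ Order.coheight ζ₁ = 2 ∧ ¬ IsClosed ({ζ₁} : Set X₁) ∧
          (∃ ζ₂ : X₁, (μ : ℕ∞) ≤ idealOrder J₁ ζ₂ ∧ Order.coheight ζ₂ = 2 ∧ ¬ IsClosed ({ζ₂} : Set X₁) ∧ ζ₁ ≠ ζ₂ ∧
            ¬ Disjoint (closure ({ζ₁} : Set X₁)) (closure {ζ₂})) ∧
          ∀ y ∈ closure ({ζ₁} : Set X₁), CleanPermissibleAt p (algebraMap (X₁.presheaf.stalk y) X₁.functionField)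
            (RatFn.functionFieldMap Φ G) (stalkIdeal (vanishingIdeal (⟨closure {ζ₁}, isClosed_closure⟩ : Closeds X₁)) y)
      · -- the PRINTED step: blow up a meeting curve of `Σ` that is clean-permissible at each of its points
        obtain ⟨ζ₁, hζ₁ord, hζ₁coh, hζ₁cl, -, hperm⟩ := hCP
        have hY : (⟨closure {ζ₁}, isClosed_closure⟩ : Closeds X₁) ∈ {C : Closeds X₁ | ∃ ζ ∈ maxPoints
            {z : X₁ | (μ : ℕ∞) ≤ idealOrder J₁ z}, ¬ IsClosed ({ζ} : Set X₁) ∧ C = ⟨closure {ζ}, isClosed_closure⟩} :=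
          ⟨ζ₁, mem_maxPoints_setOf_of_coheight_eq_two hμ hcoh3 hcodim₁ hζ₁ord hζ₁coh, hζ₁cl, rfl⟩
        have hcurve := curve_of_noBad hX₁ hX3₁ J₁ hμ hle₁ hcodim₁ (𝒞 := {C : Closeds X₁ | _}) (fun C => Iff.rfl) hI hY
        obtain ⟨hYreg, -, hYord, -, -⟩ := hcurve
        have hb := exists_isBlowup X₁ (vanishingIdeal (⟨closure {ζ₁}, isClosed_closure⟩ : Closeds X₁))
        obtain ⟨X₂, π, hπ⟩ := hb
        have hJne : J₁ ≠ ⊥ := ne_bot_of_forall_one_lt_coheight hcodim₁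
        have hYne : vanishingIdeal (⟨closure {ζ₁}, isClosed_closure⟩ : Closeds X₁) ≠ ⊥ :=
          vanishingIdeal_ne_bot_of_forall_idealOrder_eq hJne hμ hYord
        haveI : IsIntegral X₂ := hπ.isIntegral hYne
        haveI : IsDominant π := isDominant_of_isBlowup_of_ne_bot hπ hYne
        haveI : IsLocallyNoetherian X₂ := hπ.isLocallyNoetherian
        have hseq₂ : IsCleanPermissibleSeq p (π ≫ Φ) J μ
            (controlledTransform π (vanishingIdeal (⟨closure {ζ₁}, isClosed_closure⟩ : Closeds X₁)) J₁ μ) G :=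
          IsCleanPermissibleSeq.cons π Φ J μ J₁ G ⟨closure {ζ₁}, isClosed_closure⟩ hseq (isIntegral_subscheme_closure ζ₁)
            hYreg hYord hπ hperm
        -- the invariants upstairs
        obtain ⟨-, hnoeth₂, -, -, hle₂, -⟩ := inv hseq₂
        haveI := hnoeth₂
        -- no bad point upstairs, and the potential drops
        have hI₂ := curveStep_noBad hX₁ hX3₁ J₁ hμ hle₁ hcodim₁ (𝒞 := {C : Closeds X₁ | _}) (fun C => Iff.rfl) hI hY hπ
          (𝒞' := {C : Closeds X₂ | _}) (fun C' => Iff.rfl)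
        have hlt := curveStep_potential_lt hX₁ hX3₁ J₁ hμ hle₁ hcodim₁ (𝒞 := {C : Closeds X₁ | _}) (fun C => Iff.rfl) hI hY hπ
          hle₂ (hfin hseq) (hfin hseq₂)
        exact Or.inr ⟨X₂, inferInstance, π ≫ Φ, inferInstance, _, hseq₂, hI₂, hlt⟩
      · -- an (R1ⁿᶜᵖ) stage: the hypothesis, applied to the transform of `G`, then composition
        have hncp : ∀ ζ₁ : X₁, (μ : ℕ∞) ≤ idealOrder J₁ ζ₁ → Order.coheight ζ₁ = 2 → ¬ IsClosed ({ζ₁} : Set X₁) →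
            (∃ ζ₂ : X₁, (μ : ℕ∞) ≤ idealOrder J₁ ζ₂ ∧ Order.coheight ζ₂ = 2 ∧ ¬ IsClosed ({ζ₂} : Set X₁) ∧ ζ₁ ≠ ζ₂ ∧
              ¬ Disjoint (closure ({ζ₁} : Set X₁)) (closure {ζ₂})) →
            ∃ y ∈ closure ({ζ₁} : Set X₁), ¬ CleanPermissibleAt p (algebraMap (X₁.presheaf.stalk y) X₁.functionField)
              (RatFn.functionFieldMap Φ G) (stalkIdeal (vanishingIdeal (⟨closure {ζ₁}, isClosed_closure⟩ : Closeds X₁)) y) := by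
          intro ζ₁ h1 h2 h3 hm
          by_contra hno
          push Not at hno
          exact hCP ⟨ζ₁, h1, h2, h3, hm, hno⟩
        have hres := hNCP hcharX₁ hX₁ hqe₁ hX3₁ (RatFn.functionFieldMap Φ G) hG₁ J₁ hle₁ hcodim₁ hI hmeet hncp
        obtain ⟨X₂, Ψ, hX₂, hΨ, J₂, hseq', htidy⟩ := hres
        haveI := hX₂
        haveI := hΨ
        exact Or.inl ⟨X₂, Ψ ≫ Φ, inferInstance, inferInstance, J₂, hseq.comp hseq' rfl, htidy⟩
    · -- the stage is already TIDY
      refine Or.inl ⟨X₁, Φ, inferInstance, inferInstance, J₁, hseq, hREG, ?_⟩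
      intro ζ₁ ζ₂ h1 h2 h3 h4 h5 h6 hne
      by_contra hd
      exact hmeet ⟨ζ₁, ζ₂, h1, h2, h3, h4, h5, h6, hne, hd⟩
  -- STRONG INDUCTION on the potential `Λ` over the reachable stages without bad points
  have key : ∀ (n : ℕ) (X₁ : Scheme.{0}) [IsIntegral X₁] (Φ : X₁ ⟶ X) [IsDominant Φ] (J₁ : X₁.IdealSheafData),
      IsCleanPermissibleSeq p Φ J μ J₁ G →
      (∀ x : X₁, ¬ ∃ C ∈ {C : Closeds X₁ | ∃ ζ ∈ maxPoints {z : X₁ | (μ : ℕ∞) ≤ idealOrder J₁ z},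
          ¬ IsClosed ({ζ} : Set X₁) ∧ C = ⟨closure {ζ}, isClosed_closure⟩},
        x ∈ (vanishingIdeal C).subschemeι '' (Scheme.regularLocus (vanishingIdeal C).subscheme)ᶜ ∨
        (x ∈ (C : Set X₁) ∧ ∃ C' ∈ {C : Closeds X₁ | ∃ ζ ∈ maxPoints {z : X₁ | (μ : ℕ∞) ≤ idealOrder J₁ z},
            ¬ IsClosed ({ζ} : Set X₁) ∧ C = ⟨closure {ζ}, isClosed_closure⟩}, C' ≠ C ∧ x ∈ (C' : Set X₁) ∧
          stalkIdeal (vanishingIdeal C) x ⊔ stalkIdeal (vanishingIdeal C') x ≠ maximalIdeal (X₁.presheaf.stalk x))) →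
      (∑ᶠ ζ ∈ {ζ : X₁ | ζ ∈ maxPoints {z : X₁ | (μ : ℕ∞) ≤ idealOrder J₁ z} ∧ ¬ IsClosed ({ζ} : Set X₁)},
          (Module.length (X₁.presheaf.stalk ζ) (X₁.presheaf.stalk ζ ⧸ stalkIdeal J₁ ζ)).toNat) ≤ n →
      ∃ (X₂ : Scheme.{0}) (Ψ : X₂ ⟶ X) (_ : IsIntegral X₂) (_ : IsDominant Ψ) (J₂ : X₂.IdealSheafData)
        (_ : IsCleanPermissibleSeq p Ψ J μ J₂ G),
        (∀ ζ : X₂, (μ : ℕ∞) ≤ idealOrder J₂ ζ → Order.coheight ζ = 2 → ¬ IsClosed ({ζ} : Set X₂) →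
            Scheme.IsRegular (vanishingIdeal (⟨closure {ζ}, isClosed_closure⟩ : Closeds X₂)).subscheme) ∧
        (∀ ζ₁ ζ₂ : X₂, (μ : ℕ∞) ≤ idealOrder J₂ ζ₁ → Order.coheight ζ₁ = 2 → ¬ IsClosed ({ζ₁} : Set X₂) →
            (μ : ℕ∞) ≤ idealOrder J₂ ζ₂ → Order.coheight ζ₂ = 2 → ¬ IsClosed ({ζ₂} : Set X₂) → ζ₁ ≠ ζ₂ →
            Disjoint (closure ({ζ₁} : Set X₂)) (closure {ζ₂})) := by
    intro n
    induction n with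
    | zero =>
      intro X₁ _ Φ _ J₁ hseq hI hΛ
      rcases step X₁ Φ J₁ hseq hI with hdone | ⟨X₂, hX₂, Φ₂, hΦ₂, J₂, -, -, hlt⟩
      · exact hdone
      · exfalso
        omega
    | succ n ih =>
      intro X₁ _ Φ _ J₁ hseq hI hΛ
      rcases step X₁ Φ J₁ hseq hI with hdone | ⟨X₂, hX₂, Φ₂, hΦ₂, J₂, hseq₂, hI₂, hlt⟩
      · exact hdone
      · haveI := hX₂
        haveI := hΦ₂
        exact ih X₂ Φ₂ J₂ hseq₂ hI₂ (by omega)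
  -- start of the induction: the empty sequence
  have h0 := key _ X (𝟙 X) J (IsCleanPermissibleSeq.nil J μ G) hRT le_rfl
  exact h0

/-! ## §2 (R1) ⟸ (R1ⁿᶜᵖ) as hypothesis schemas -/

set_option maxHeartbeats 800000 in
-- long binder lists
/-- **(R1) ⟸ (R1ⁿᶜᵖ)**: the hypothesis `hphaseTwo` of ✓ `cleanProp44_of_phaseTwo_of_curveTauOneVN` (clean Phase II of reach-tidy, VERBATIM)
follows from its restriction (R1ⁿᶜᵖ) to the stages at which two curves of `Σ` meet and every curve of `Σ` meeting another one has a point where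
the line is not clean-permissible for it (hypotheses `(meet)`, `(ncp)` inserted; everything else verbatim) — by
`exists_isCleanPermissibleSeq_tidy_of_noBad_of_NCP` at each prime. [cite: CossartPiltant2008, Prop. 4.4 (proof, p. 10, step 3)]
[cite: Piltant2013, §2 Axiom 4] -/
theorem phaseTwo_of_phaseTwoNCP
    (hphaseTwoNCP : ∀ (p : ℕ), p.Prime → ∀ {X : Scheme.{0}} [IsIntegral X] [IsNoetherian X], CharP X.functionField p →
      ∀ (hX : Scheme.IsRegular X), Scheme.IsQuasiExcellent X → topologicalKrullDim X ≤ 3 →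
      ∀ (G : X.functionField), (∀ x : X, CleanRegAt p (algebraMap (X.presheaf.stalk x) X.functionField) G) →
      ∀ (J : X.IdealSheafData) {μ : ℕ}, 1 ≤ μ → (∀ z, idealOrder J z ≤ μ) → (∀ z ∈ J.support, 1 < Order.coheight z) →
      (∀ x : X, ¬ ∃ C ∈ {C : Closeds X | ∃ ζ ∈ maxPoints {z : X | (μ : ℕ∞) ≤ idealOrder J z},
          ¬ IsClosed ({ζ} : Set X) ∧ C = ⟨closure {ζ}, isClosed_closure⟩},
        x ∈ (vanishingIdeal C).subschemeι '' (Scheme.regularLocus (vanishingIdeal C).subscheme)ᶜ ∨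
        (x ∈ (C : Set X) ∧ ∃ C' ∈ {C : Closeds X | ∃ ζ ∈ maxPoints {z : X | (μ : ℕ∞) ≤ idealOrder J z},
            ¬ IsClosed ({ζ} : Set X) ∧ C = ⟨closure {ζ}, isClosed_closure⟩}, C' ≠ C ∧ x ∈ (C' : Set X) ∧
          stalkIdeal (vanishingIdeal C) x ⊔ stalkIdeal (vanishingIdeal C') x ≠ maximalIdeal (X.presheaf.stalk x))) →
      -- (meet) two distinct curves of `Σ` meet
      (∃ ζ₁ ζ₂ : X, (μ : ℕ∞) ≤ idealOrder J ζ₁ ∧ Order.coheight ζ₁ = 2 ∧ ¬ IsClosed ({ζ₁} : Set X) ∧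
          (μ : ℕ∞) ≤ idealOrder J ζ₂ ∧ Order.coheight ζ₂ = 2 ∧ ¬ IsClosed ({ζ₂} : Set X) ∧ ζ₁ ≠ ζ₂ ∧
          ¬ Disjoint (closure ({ζ₁} : Set X)) (closure {ζ₂})) →
      -- (ncp) every curve of `Σ` meeting another one has a point at which the line is NOT clean-permissible for it
      (∀ ζ₁ : X, (μ : ℕ∞) ≤ idealOrder J ζ₁ → Order.coheight ζ₁ = 2 → ¬ IsClosed ({ζ₁} : Set X) →
          (∃ ζ₂ : X, (μ : ℕ∞) ≤ idealOrder J ζ₂ ∧ Order.coheight ζ₂ = 2 ∧ ¬ IsClosed ({ζ₂} : Set X) ∧ ζ₁ ≠ ζ₂ ∧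
            ¬ Disjoint (closure ({ζ₁} : Set X)) (closure {ζ₂})) →
          ∃ y ∈ closure ({ζ₁} : Set X), ¬ CleanPermissibleAt p (algebraMap (X.presheaf.stalk y) X.functionField) G
            (stalkIdeal (vanishingIdeal (⟨closure {ζ₁}, isClosed_closure⟩ : Closeds X)) y)) →
      ∃ (X₁ : Scheme.{0}) (Φ : X₁ ⟶ X) (_ : IsIntegral X₁) (_ : IsDominant Φ) (J₁ : X₁.IdealSheafData)
        (_ : IsCleanPermissibleSeq p Φ J μ J₁ G),
        (∀ ζ : X₁, (μ : ℕ∞) ≤ idealOrder J₁ ζ → Order.coheight ζ = 2 → ¬ IsClosed ({ζ} : Set X₁) →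
            Scheme.IsRegular (vanishingIdeal (⟨closure {ζ}, isClosed_closure⟩ : Closeds X₁)).subscheme) ∧
        (∀ ζ₁ ζ₂ : X₁, (μ : ℕ∞) ≤ idealOrder J₁ ζ₁ → Order.coheight ζ₁ = 2 → ¬ IsClosed ({ζ₁} : Set X₁) →
            (μ : ℕ∞) ≤ idealOrder J₁ ζ₂ → Order.coheight ζ₂ = 2 → ¬ IsClosed ({ζ₂} : Set X₁) → ζ₁ ≠ ζ₂ →
            Disjoint (closure ({ζ₁} : Set X₁)) (closure {ζ₂}))) :
    ∀ (p : ℕ), p.Prime → ∀ {X : Scheme.{0}} [IsIntegral X] [IsNoetherian X], CharP X.functionField p →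
      ∀ (hX : Scheme.IsRegular X), Scheme.IsQuasiExcellent X → topologicalKrullDim X ≤ 3 →
      ∀ (G : X.functionField), (∀ x : X, CleanRegAt p (algebraMap (X.presheaf.stalk x) X.functionField) G) →
      ∀ (J : X.IdealSheafData) {μ : ℕ}, 1 ≤ μ → (∀ z, idealOrder J z ≤ μ) → (∀ z ∈ J.support, 1 < Order.coheight z) →
      (∀ x : X, ¬ ∃ C ∈ {C : Closeds X | ∃ ζ ∈ maxPoints {z : X | (μ : ℕ∞) ≤ idealOrder J z},
          ¬ IsClosed ({ζ} : Set X) ∧ C = ⟨closure {ζ}, isClosed_closure⟩},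
        x ∈ (vanishingIdeal C).subschemeι '' (Scheme.regularLocus (vanishingIdeal C).subscheme)ᶜ ∨
        (x ∈ (C : Set X) ∧ ∃ C' ∈ {C : Closeds X | ∃ ζ ∈ maxPoints {z : X | (μ : ℕ∞) ≤ idealOrder J z},
            ¬ IsClosed ({ζ} : Set X) ∧ C = ⟨closure {ζ}, isClosed_closure⟩}, C' ≠ C ∧ x ∈ (C' : Set X) ∧
          stalkIdeal (vanishingIdeal C) x ⊔ stalkIdeal (vanishingIdeal C') x ≠ maximalIdeal (X.presheaf.stalk x))) →
      ∃ (X₁ : Scheme.{0}) (Φ : X₁ ⟶ X) (_ : IsIntegral X₁) (_ : IsDominant Φ) (J₁ : X₁.IdealSheafData)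
        (_ : IsCleanPermissibleSeq p Φ J μ J₁ G),
        (∀ ζ : X₁, (μ : ℕ∞) ≤ idealOrder J₁ ζ → Order.coheight ζ = 2 → ¬ IsClosed ({ζ} : Set X₁) →
            Scheme.IsRegular (vanishingIdeal (⟨closure {ζ}, isClosed_closure⟩ : Closeds X₁)).subscheme) ∧
        (∀ ζ₁ ζ₂ : X₁, (μ : ℕ∞) ≤ idealOrder J₁ ζ₁ → Order.coheight ζ₁ = 2 → ¬ IsClosed ({ζ₁} : Set X₁) →
            (μ : ℕ∞) ≤ idealOrder J₁ ζ₂ → Order.coheight ζ₂ = 2 → ¬ IsClosed ({ζ₂} : Set X₁) → ζ₁ ≠ ζ₂ →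
            Disjoint (closure ({ζ₁} : Set X₁)) (closure {ζ₂})) := by
  intro p hp X _ _ hchar hX hqe hX3 G hG J μ hμ hle hcodim hRT
  haveI := hchar
  exact exists_isCleanPermissibleSeq_tidy_of_noBad_of_NCP hp hX hqe hX3 G hG J hμ hle hcodim hRT
    (fun hch hY hYqe hY3 GY hGY JY hleY hcodY hRTY hmeet hncp =>
      hphaseTwoNCP p hp hch hY hYqe hY3 GY hGY JY hμ hleY hcodY hRTY hmeet hncp)

/-! ## §3 ELEVENTH CUT: X44c ⟸ (R1ⁿᶜᵖ) ∧ (R3ᵛⁿ′) -/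

set_option maxHeartbeats 1600000 in
-- long binder lists
/-- **THE CLEAN ASSEMBLY, ELEVENTH CUT: X44c (`stub_cleanProp44`, verbatim) ⟸ (R1ⁿᶜᵖ) clean Phase II of reach-tidy AT THE STAGES WHERE INSERTIONS
ARE FORCED ON EVERY INTERSECTING `Σ`-CURVE ∧ (R3ᵛⁿ′) the clean curve slice for curves through a `τ = 1` point that need an insertion or carry a
very near point** — the hypothesis `hcurveTauOneVN` of ✓ `cleanProp44_of_phaseTwo_of_curveTauOneVN` VERBATIM, its hypothesis `hphaseTwo` NARROWED to
`hphaseTwoNCP` by `phaseTwo_of_phaseTwoNCP` (the printed potential of [CoP1] p. 10 step 3 absorbs every clean-permissible intersecting curve).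
[cite: CossartPiltant2008, Prop. 4.2 (b), Prop. 4.4 (proof, p. 10, step 3), Lemma 4.5] [cite: CossartJannsenSaito2020, Thm. 13.7]
[cite: Piltant2013, §2 Axiom 4, Prop. 5.1 (proof, Step 2)] -/
theorem cleanProp44_of_phaseTwoNCP_of_curveTauOneVN
    (hphaseTwoNCP : ∀ (p : ℕ), p.Prime → ∀ {X : Scheme.{0}} [IsIntegral X] [IsNoetherian X], CharP X.functionField p →
      ∀ (hX : Scheme.IsRegular X), Scheme.IsQuasiExcellent X → topologicalKrullDim X ≤ 3 →
      ∀ (G : X.functionField), (∀ x : X, CleanRegAt p (algebraMap (X.presheaf.stalk x) X.functionField) G) →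
      ∀ (J : X.IdealSheafData) {μ : ℕ}, 1 ≤ μ → (∀ z, idealOrder J z ≤ μ) → (∀ z ∈ J.support, 1 < Order.coheight z) →
      (∀ x : X, ¬ ∃ C ∈ {C : Closeds X | ∃ ζ ∈ maxPoints {z : X | (μ : ℕ∞) ≤ idealOrder J z},
          ¬ IsClosed ({ζ} : Set X) ∧ C = ⟨closure {ζ}, isClosed_closure⟩},
        x ∈ (vanishingIdeal C).subschemeι '' (Scheme.regularLocus (vanishingIdeal C).subscheme)ᶜ ∨
        (x ∈ (C : Set X) ∧ ∃ C' ∈ {C : Closeds X | ∃ ζ ∈ maxPoints {z : X | (μ : ℕ∞) ≤ idealOrder J z},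
            ¬ IsClosed ({ζ} : Set X) ∧ C = ⟨closure {ζ}, isClosed_closure⟩}, C' ≠ C ∧ x ∈ (C' : Set X) ∧
          stalkIdeal (vanishingIdeal C) x ⊔ stalkIdeal (vanishingIdeal C') x ≠ maximalIdeal (X.presheaf.stalk x))) →
      -- (meet) two distinct curves of `Σ` meet
      (∃ ζ₁ ζ₂ : X, (μ : ℕ∞) ≤ idealOrder J ζ₁ ∧ Order.coheight ζ₁ = 2 ∧ ¬ IsClosed ({ζ₁} : Set X) ∧
          (μ : ℕ∞) ≤ idealOrder J ζ₂ ∧ Order.coheight ζ₂ = 2 ∧ ¬ IsClosed ({ζ₂} : Set X) ∧ ζ₁ ≠ ζ₂ ∧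
          ¬ Disjoint (closure ({ζ₁} : Set X)) (closure {ζ₂})) →
      -- (ncp) every curve of `Σ` meeting another one has a point at which the line is NOT clean-permissible for it
      (∀ ζ₁ : X, (μ : ℕ∞) ≤ idealOrder J ζ₁ → Order.coheight ζ₁ = 2 → ¬ IsClosed ({ζ₁} : Set X) →
          (∃ ζ₂ : X, (μ : ℕ∞) ≤ idealOrder J ζ₂ ∧ Order.coheight ζ₂ = 2 ∧ ¬ IsClosed ({ζ₂} : Set X) ∧ ζ₁ ≠ ζ₂ ∧
            ¬ Disjoint (closure ({ζ₁} : Set X)) (closure {ζ₂})) →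
          ∃ y ∈ closure ({ζ₁} : Set X), ¬ CleanPermissibleAt p (algebraMap (X.presheaf.stalk y) X.functionField) G
            (stalkIdeal (vanishingIdeal (⟨closure {ζ₁}, isClosed_closure⟩ : Closeds X)) y)) →
      ∃ (X₁ : Scheme.{0}) (Φ : X₁ ⟶ X) (_ : IsIntegral X₁) (_ : IsDominant Φ) (J₁ : X₁.IdealSheafData)
        (_ : IsCleanPermissibleSeq p Φ J μ J₁ G),
        (∀ ζ : X₁, (μ : ℕ∞) ≤ idealOrder J₁ ζ → Order.coheight ζ = 2 → ¬ IsClosed ({ζ} : Set X₁) →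
            Scheme.IsRegular (vanishingIdeal (⟨closure {ζ}, isClosed_closure⟩ : Closeds X₁)).subscheme) ∧
        (∀ ζ₁ ζ₂ : X₁, (μ : ℕ∞) ≤ idealOrder J₁ ζ₁ → Order.coheight ζ₁ = 2 → ¬ IsClosed ({ζ₁} : Set X₁) →
            (μ : ℕ∞) ≤ idealOrder J₁ ζ₂ → Order.coheight ζ₂ = 2 → ¬ IsClosed ({ζ₂} : Set X₁) → ζ₁ ≠ ζ₂ →
            Disjoint (closure ({ζ₁} : Set X₁)) (closure {ζ₂})))
    (hcurveTauOneVN : ∀ (p : ℕ), p.Prime → ∀ {X : Scheme.{0}} [IsIntegral X] [IsNoetherian X], CharP X.functionField p →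
      ∀ (hX : Scheme.IsRegular X), Scheme.IsQuasiExcellent X → topologicalKrullDim X ≤ 3 →
      ∀ (G : X.functionField), (∀ x : X, CleanRegAt p (algebraMap (X.presheaf.stalk x) X.functionField) G) →
      ∀ (J : X.IdealSheafData) {m : ℕ}, 1 ≤ m → (∀ z, idealOrder J z ≤ m) → (∀ z ∈ J.support, 1 < Order.coheight z) →
      ∀ (V : X.Opens) (Y : Closeds X), Scheme.IsRegular (vanishingIdeal Y).subscheme → IsIrreducible (Y : Set X) →
      (Y : Set X) ⊆ (V : Set X) → (∀ z : X, (m : ℕ∞) ≤ idealOrder J z → z ∈ (Y : Set X) ∨ z ∉ (V : Set X)) →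
      (∀ y ∈ (Y : Set X), idealOrder J y = m) →
      (∀ y ∈ (Y : Set X), haveI := hX y; ∃ c : Fin 2 → X.presheaf.stalk y, IsRsopPart c ∧
        Ideal.span (Set.range c) = stalkIdeal (vanishingIdeal Y) y) →
      (¬ ∀ y ∈ (Y : Set X), IsClosed ({y} : Set X) → haveI := hX y; 2 ≤ stalkTau J y m) →
      -- (VN′) NOT (clean-permissible at every point of `Y` AND no very near point over `Y` for the blowing ups of `X` along `Y`)
      (¬ ((∀ y ∈ (Y : Set X), CleanPermissibleAt p (algebraMap (X.presheaf.stalk y) X.functionField) G (stalkIdeal (vanishingIdeal Y) y)) ∧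
          (∀ (X₁ : Scheme.{0}) (π : X₁ ⟶ X), IsBlowup π (vanishingIdeal Y) →
            ∀ x' : X₁, IsClosed ({x'} : Set X₁) → π x' ∈ (Y : Set X) →
              idealOrder (controlledTransform π (vanishingIdeal Y) J m) x' = m →
              (maximalIdeal (X₁.presheaf.stalk x')).spanFinrank = 3 →
              ∀ hr : IsRegularLocalRing (X₁.presheaf.stalk x'), 2 ≤ @stalkTau X₁ (controlledTransform π (vanishingIdeal Y) J m) x' hr m))) →
      ∀ [IsIntegral ((V : X.Opens) : Scheme.{0})] [IsDominant V.ι],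
      ∃ (V' : Scheme.{0}) (π : V' ⟶ V) (_ : IsIntegral V') (_ : IsDominant π) (K' : V'.IdealSheafData),
        IsCleanPermissibleSeq p π (J.comap V.ι) m K' (RatFn.functionFieldMap V.ι G) ∧ ∀ y, idealOrder K' y < m) :
    ∀ (p : ℕ), p.Prime → ∀ (S : Scheme.{0}) [IsIntegral S] [IsNoetherian S],
      CharP S.functionField p → Scheme.IsRegular S → Scheme.IsExcellent S → topologicalKrullDim S = 3 →
      ∀ G₀ : S.functionField, (∀ s : S, CleanRegAt p (algebraMap (S.presheaf.stalk s) S.functionField) G₀) →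
      ∀ I : S.IdealSheafData, I ≠ ⊥ →
      ∀ (X : Scheme.{0}) (ρ : X ⟶ S) [IsIntegral X] [IsNoetherian X] [IsDominant ρ],
        IsCleanRegularCentreBlowupSeq p ρ I G₀ →
        (∀ x : X, CleanRegAt p (algebraMap (X.presheaf.stalk x) X.functionField) (RatFn.functionFieldMap ρ G₀)) →
        ∀ (J : X.IdealSheafData) (μ : ℕ), 1 ≤ μ →
          (∀ x ∈ J.support, 1 < Order.coheight x) → (∀ x, idealOrder J x ≤ μ) → (∃ x, idealOrder J x = μ) →
          ∃ (X' : Scheme.{0}) (π : X' ⟶ X) (_ : IsIntegral X') (_ : IsDominant π) (J' : X'.IdealSheafData),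
            IsCleanPermissibleSeq p π J μ J' (RatFn.functionFieldMap ρ G₀) ∧ ∀ x, idealOrder J' x < μ :=
  cleanProp44_of_phaseTwo_of_curveTauOneVN (phaseTwo_of_phaseTwoNCP hphaseTwoNCP) hcurveTauOneVN

end Summit.ResolutionOfSingularities.ResolutionOfSingularities.Theorems.RadicialJung.CleanModels

end
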